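import Literature.NumberTheory.GaloisCohomology.Howard2004.SelmerARepresentativeProofs
import HarnessLib

/-!
# Representatives of `H¹_F(K, A)` adapted to ONE place: `a = [c]` with `loc_v c ∈ F_{k,v}` on the nose
# (Howard 2004 §1.6) — proofs file

Topic `NumberTheory/GaloisCohomology/Howard2004` (sequel to `SelmerARepresentativeProofs`: `AdicTower.mem_selmerA_iff`,
`mem_condA_iff`, `incH1LE_incH1LE`, `localization_incH1`). THEOREMS ONLY: no definition, no named fact, no instance,
no `sorry`.

WHY (cell `pub/bsd-print-x9`, shared μ-crux `MuInequalityCoherentPairOfPrint{,CG}`, STUB B `stub_controlGlue`, the Selmer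
clause `Stmt.readoutSelmer` (B4), seat `bsd-line-x10b-p2` g8). The propagated condition `condA F j v` is a directed union
`⋃_d incLocIter⁻¹(F_{j+d,v})`: a Selmer class `c` at level `j` satisfies, at a given place `v`, only
`incLocIter j v d (loc_v c) ∈ F_{j+d,v}` for SOME `d`.  Moving the representative `d` levels up (`incH1LE j (j+d) c`, same
class in `H¹(K, A)`), its localisation IS in `F_{j+d,v}` — the form in which the place-wise readout lemmas of the curve
(`WeierstrassCurve.eisensteinTowerReadout_of_mem_localKerOver`, `…_resH1Hom_inertiaInToH_eq_zero_of_mem_levelCondition`,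
`…_mem_localKerOver_of_decomp_le`) consume local conditions.

* `AdicTower.localization_incH1LE_add` — `loc_v (incH1LE j (j+d) c) = incLocIter j v d (loc_v c)`;
* **`AdicTower.exists_of_eq_localization_mem`** — for `a ∈ H¹_F(K, A)` and a place `v`: `a = [c]` with `c` at some level
  `k` and `loc_v c ∈ F_{k,v}`;
* `DVRSetting.exists_of_eq_localization_mem` — the same for a `DVRSetting` with H.0–H.5 (`F = (S.t ·).cond`).

References: [Howard2004HeegnerKolyvagin] B. Howard, Compositio Math. 140 (2004), Def. 1.1.1, Def. 1.1.3, §1.6 / Thm. 1.6.1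
(arXiv:1202.6340 p. 5 L20–45, p. 11 L18–28, p. 12 L40–48); [SerreGaloisCohomology1997] I §2.4.  BSD is not proved by any of this.
-/

set_option autoImplicit false

noncomputable section

open Function NumberField IsDedekindDomain Field
open scoped NumberField ContRepresentation

namespace Literature.NumberTheory.GaloisCohomology.Howard2004

open Literature.NumberTheory.GaloisRepresentations
open Literature.NumberTheory.GaloisRepresentations.DiscreteGaloisModule
open Literature.NumberTheory.GaloisRepresentations.galoisCohomology

namespace AdicTower

variable {K : Type} [Field K] [NumberField K] {R : Type} [CommRing R] [IsLocalRing R]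
  {N : ℕ → Type} [∀ k, AddCommGroup (N k)] [∀ k, TopologicalSpace (N k)] [∀ k, DiscreteTopology (N k)]
  [∀ k, Module R (N k)]
  (T : AdicTower K R N) (π : R) (e : ℕ → ℕ)
  (hkill : ∀ k, ∀ r ∈ IsLocalRing.maximalIdeal R ^ e k, ∀ x : N k, r • x = 0)
  (hker : ∀ k, LinearMap.ker (T.red k) = (IsLocalRing.maximalIdeal R ^ e k) • (⊤ : Submodule R (N (k + 1))))
  (hπ : π ∈ IsLocalRing.maximalIdeal R) (he : ∀ k, e k ≤ e (k + 1))

/-- **`loc_v (incH1LE j (j+d) c) = incLocIter j v d (loc_v c)`**: localisation commutes with the iterated transition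
maps (induction on `d` from `localization_incH1`). [cite: Howard2004HeegnerKolyvagin, §1.6 (arXiv p. 11 L18–20, p. 12 L40–48)]
[cite: SerreGaloisCohomology1997, Ch. I §2.4] -/
theorem localization_incH1LE_add (j : ℕ) (v : Place K) (c : galoisCohomology (T.ρ j) 1) :
    ∀ (d : ℕ) (h : j ≤ j + d),
      galoisCohomology.localization (T.ρ (j + d)) v 1 (incH1LE T π e hkill hker hπ he j (j + d) h c) =
        incLocIter T π e hkill hker hπ he j v d (galoisCohomology.localization (T.ρ j) v 1 c)
  | 0, h => by
    have h0 : incH1LE T π e hkill hker hπ he j j h = AddMonoidHom.id _ := Nat.leRec_self _ _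
    change galoisCohomology.localization (T.ρ j) v 1 (incH1LE T π e hkill hker hπ he j j h c) =
      galoisCohomology.localization (T.ρ j) v 1 c
    rw [h0]
    rfl
  | d + 1, h => by
    have h1 : incH1LE T π e hkill hker hπ he j (j + d + 1) h =
        (incH1 T π e hkill hker hπ he (j + d)).comp (incH1LE T π e hkill hker hπ he j (j + d) (Nat.le_add_right j d)) :=
      Nat.leRec_succ _ _ (Nat.le_add_right j d)
    change galoisCohomology.localization (T.ρ (j + d + 1)) v 1 (incH1LE T π e hkill hker hπ he j (j + d + 1) h c) =
      incLoc T π e hkill hker hπ he (j + d) v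
        (incLocIter T π e hkill hker hπ he j v d (galoisCohomology.localization (T.ρ j) v 1 c))
    rw [h1, AddMonoidHom.comp_apply, localization_incH1, localization_incH1LE_add j v c d]

/-- **A representative adapted to one place.** For `a ∈ H¹_F(K, A)` and a place `v` there are a level `k` and a class
`c ∈ H¹(K, T_k)` with `[c] = a` whose localisation at `v` lies in `F_{k,v}` ITSELF (not merely in the propagated
`condA F k v`): take a Selmer representative at level `j` (`mem_selmerA_iff`), a `d` with
`incLocIter j v d (loc_v c) ∈ F_{j+d,v}` (`mem_condA_iff`), and move the representative to level `j + d`.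
[cite: Howard2004HeegnerKolyvagin, Def. 1.1.1, §1.6 / Thm. 1.6.1 (arXiv p. 5 L20–24, p. 11 L18–28, p. 12 L40–48)] -/
theorem exists_of_eq_localization_mem (F : ∀ k, SelmerStructure (T.ρ k))
    (hred : ∀ (k : ℕ) (v : Place K), ((F (k + 1)) v).map
      (ContinuousRep.cohomologyMap ((T.ρ (k + 1)).toLocal v) ((T.ρ k).toLocal v)
        (T.red k).toAddMonoidHom continuous_of_discreteTopology
        (fun _ x => T.red_equivariant k _ x) 1) = F k v)
    (hsmul : ∀ (k : ℕ) (v : Place K) (r : R), (F k v).map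
      (scalarMapH1 ((T.ρ k).toLocal v) ((T.hlin k).restrictField _) r) ≤ F k v)
    {a : H1A T π e hkill hker hπ he} (ha : a ∈ selmerA T π e hkill hker hπ he F) (v : Place K) :
    ∃ (k : ℕ) (c : galoisCohomology (T.ρ k) 1),
      AddCommGroup.DirectLimit.of (fun k => galoisCohomology (T.ρ k) 1) (incH1LE T π e hkill hker hπ he) k c = a ∧
        galoisCohomology.localization (T.ρ k) v 1 c ∈ F k v := by
  obtain ⟨j, c, hc, rfl⟩ := (mem_selmerA_iff T π e hkill hker hπ he F hred hsmul a).1 ha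
  rw [SelmerStructure.mem_selmerGroup_iff] at hc
  obtain ⟨d, hd⟩ := (mem_condA_iff T π e hkill hker hπ he F hred hsmul j v _).1 (hc v)
  refine ⟨j + d, incH1LE T π e hkill hker hπ he j (j + d) (Nat.le_add_right j d) c, ?_, ?_⟩
  · exact AddCommGroup.DirectLimit.of_f (G := fun k => galoisCohomology (T.ρ k) 1)
      (f := incH1LE T π e hkill hker hπ he) (Nat.le_add_right j d) c
  · rw [localization_incH1LE_add]
    exact hd

end AdicTower

/-! ## For a `DVRSetting` with H.0–H.5 -/

namespace DVRSetting

variable {p : ℕ} [Fact p.Prime] {K : Type} [Field K] [NumberField K]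
  {R : Type} [CommRing R] [IsDomain R] [IsDiscreteValuationRing R] [Algebra ℤ_[p] R]
  {N : ℕ → Type} [∀ k, AddCommGroup (N k)] [∀ k, TopologicalSpace (N k)] [∀ k, DiscreteTopology (N k)]
  [∀ k, Module R (N k)]
  {Rk : ℕ → Type} [∀ k, CommRing (Rk k)] [∀ k, IsLocalRing (Rk k)] [∀ k, TopologicalSpace (Rk k)]
  [∀ k, DiscreteTopology (Rk k)] [∀ k, Algebra ℤ_[p] (Rk k)] [∀ k, Algebra R (Rk k)]
  [∀ k, Module (Rk k) (N k)] [∀ k, IsScalarTower R (Rk k) (N k)]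
  {Nbar : Type} [AddCommGroup Nbar] [TopologicalSpace Nbar] [DiscreteTopology Nbar] [∀ k, Module (Rk k) Nbar]
  {Nq : ℕ → Finset (HeightOneSpectrum (𝓞 K)) → Type} [∀ k n, AddCommGroup (Nq k n)]
  [∀ k n, TopologicalSpace (Nq k n)] [∀ k n, DiscreteTopology (Nq k n)] [∀ k n, Module (Rk k) (Nq k n)]
  [∀ k n, Module R (Nq k n)] [∀ k n, IsScalarTower R (Rk k) (Nq k n)]
  (S : DVRSetting p K R N Rk Nbar Nq) (hy : S.SatisfiesH)

/-- **A representative adapted to one place, for a `DVRSetting` with H.0–H.5** (`F = (S.t ·).cond`; the hypotheses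
`cond_red`/`cond_smul` of the generic lemma are fields of `SatisfiesH`; any proofs `hπ`, `he`): for `a ∈ H¹_F(K, A)` and
a place `v`, `a = [c]` with `c` at some level `k` and `loc_v c ∈ (S.t k).cond v`.
[cite: Howard2004HeegnerKolyvagin, Def. 1.1.1, Def. 1.1.3 and Thm. 1.6.1 (arXiv p. 5 L20–45, p. 11 L18–28)] -/
theorem exists_of_eq_localization_mem (hπ : S.π ∈ IsLocalRing.maximalIdeal R) (he : ∀ k, S.e k ≤ S.e (k + 1))
    {a : AdicTower.H1A S.T S.π S.e hy.killed hy.ker_red hπ he}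
    (ha : a ∈ S.T.selmerA S.π S.e hy.killed hy.ker_red hπ he (fun k => (S.t k).cond)) (v : Place K) :
    ∃ (k : ℕ) (c : galoisCohomology (S.T.ρ k) 1),
      AddCommGroup.DirectLimit.of (fun k => galoisCohomology (S.T.ρ k) 1)
          (AdicTower.incH1LE S.T S.π S.e hy.killed hy.ker_red hπ he) k c = a ∧
        galoisCohomology.localization (S.T.ρ k) v 1 c ∈ (S.t k).cond v :=
  AdicTower.exists_of_eq_localization_mem S.T S.π S.e hy.killed hy.ker_red hπ he (fun k => (S.t k).cond)
    hy.cond_red hy.cond_smul ha v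

end DVRSetting

end Literature.NumberTheory.GaloisCohomology.Howard2004

end
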